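import Summits.BirchSwinnertonDyer.BirchSwinnertonDyer.Theorems.GenusKolyvaginAtTwoMinimalTwinBSDTwoTwinHalvingDescentDepthOne
import HarnessLib

/-!
# Route `GenusKolyvaginAtTwo`, crux U₂ `MinimalTwinBSDTwo` (stmt-BirchSwinnertonDyer-22985), LINE 23 «twin_swap» — THE DOOR-CLOSED FRAME IN ROUTE
# VOCABULARY: `#Sel₂(Wd) ≠ 1` gives the nonzero `2^M`-Selmer class of the twin that the swapped halving descent consumes, so
# U₂ ⟸ WALL row 1 + PRINT + Q2 + «one odd Heegner budget frame of exact depth 1 with `#Sel₂(Wd) ≠ 1`»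

Seat `bsd-line-gk2-p2` g32 (PROVER seat 2/3, cell `bsd-f1-sign2`, LINE 23 holder), `--supports stmt-BirchSwinnertonDyer-22985 --as helper`.
THEOREMS ONLY (no definition, no named fact, no `sorry`).  BSD is NOT proved by any of this; U₂ is NOT proved; nothing is closed.

WHAT.  Bookkeeping for this seat's `…TwinHalvingDescentDepthOne` (FRAME¹ asked for «a nonzero class in `Sel_(2^M)(W^{(d_K)}/ℚ)`, `M ≥ 2`»): for a
globally minimal twin model `Wd = Cd • W^{(d_K)}` the route's door bit `#Sel₂(Wd) ≠ 1` (items K1/K4, LINE 25) supplies that class — `#Sel₂` is a model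
invariant (`natCard_selmerGroup_smul`), a `2`-Selmer group of cardinality `≠ 1` has a nonzero element, and the change of level
`ι : Sel₂ → Sel₄` of the twin is injective (through `hPsiKT ∘ res` and McCallum's injectivity of `ι` on `H¹(K, W[2^·])`, naturality
`resTorsion_torsionH1OfDvd` / `hPsiKT_torsionH1OfDvd`).
* §1 `exists_selmer_twist_four_ne_zero_of_natCard_selmerGroup_two_ne_one` — the nonzero class at level `4`.
* §2 `minimalTwinBSDTwo_onOddCut_of_wall_of_doorClosedDepthOneFrameSupply_of_facts` — **U₂ on the WHOLE odd habitat cut ⟸ WALL row 1 + PRINT + Q2 +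
  FRAME¹♯** (per `W`: one odd Heegner frame `≠ ℚ(√−3)`, an odd-`c` datum, `P(1)` non-torsion of exact depth one, a globally minimal twin model `Wd` inside
  the genus budget WITH `#Sel₂(Wd) ≠ 1`) — the depth-one door-closed cell of LINE 23 in the route's own vocabulary, NO Kolyvagin-conjecture input.
CONDITIONAL on the displayed hypotheses; FRAME¹♯ is OPEN; BSD is NOT proved.

References: [Kolyvagin1989Izv] Thm. B_l; [McCallumLMS1991] §4 (5), §5; [SilvermanAEC2009] X.4.2; [MazurRubin2010] Cor. 3.4 (i).
-/

set_option autoImplicit false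
set_option linter.dupNamespace false -- `Summit.<P>.<Sub>` repeats `BirchSwinnertonDyer` (D-0017)

noncomputable section

open scoped Classical

namespace Summit.BirchSwinnertonDyer.BirchSwinnertonDyer.Theorems.GenusExact.TwinSwap.TwinAnnihilation

open Literature.NumberTheory.EllipticCurves Literature.NumberTheory.GaloisRepresentations WeierstrassCurve NumberField
  IsDedekindDomain Field AddSubgroup Literature.NumberTheory.EllipticCurves.ModularForms
open Summit.BirchSwinnertonDyer.Rank1Residual
open Summit.BirchSwinnertonDyer.BirchSwinnertonDyer.Theses.GenusKolyvaginAtTwo (KolyvaginRelationAtTwo)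
open Summit.BirchSwinnertonDyer.BirchSwinnertonDyer.Theorems.GenusExact

/-! ## §1 A nonzero `4`-Selmer class of the twin from `#Sel₂(Wd) ≠ 1` -/

/-- **`#Sel₂(Wd) ≠ 1` for a model `Wd = Cd • W^{(d_K)}` gives a NONZERO class in `Sel_(2^(1+1))(W^{(d_K)}/ℚ)`** (`K` imaginary quadratic, `ρ̄_{W,2}`
onto): `#Sel₂` is a model invariant; a subgroup of cardinality `≠ 1` has a nonzero element; the change of level `Sel₂ → Sel₄` on the twin is injective —
through `hPsiKT ∘ res` (injective: `E′(K)[·] = 0`) it is McCallum's injective `ι` on `H¹(K, W[2^·])`. [cite: McCallumLMS1991, §4 (5)]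
[cite: SilvermanAEC2009, Thm. X.4.2] -/
theorem exists_selmer_twist_four_ne_zero_of_natCard_selmerGroup_two_ne_one
    (W : WeierstrassCurve ℚ) [W.IsElliptic] [W.IsGloballyMinimal]
    (K : Type) [Field K] [NumberField K] (hIQ : IsImaginaryQuadratic K) (hs2 : W.HasSurjectiveModNGaloisRep 2)
    [(W.quadraticTwist ((NumberField.discr K : ℤ) : ℚ)).IsElliptic]
    {Wd : WeierstrassCurve ℚ} [Wd.IsElliptic] (Cd : VariableChange ℚ) (hWd : Cd • W.quadraticTwist (NumberField.discr K : ℚ) = Wd)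
    (hcard : Nat.card (Wd.selmerGroup 2) ≠ 1) :
    ∃ s₀ : galH1Torsion (W.quadraticTwist ((NumberField.discr K : ℤ) : ℚ)) ((2 ^ (1 + 1) : ℕ) : ℤ),
      s₀ ∈ selmerGroup (W.quadraticTwist ((NumberField.discr K : ℤ) : ℚ)) ((2 ^ (1 + 1) : ℕ) : ℤ) ∧ s₀ ≠ 0 := by
  have h2 : Module.finrank ℚ K = 2 := hIQ.1
  obtain ⟨θ, hθ, hd⟩ := Literature.NumberTheory.QuadraticFields.Quadratic.exists_not_mem_range_sq_eq_discr (K := K) h2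
  -- no `2`-power torsion in `E(K)`
  have htorsK : ∀ (m : ℕ) (P : (W.baseChange K).toAffine.Point), ((2 ^ m : ℕ) : ℤ) • P = 0 → P = 0 := fun m P hP ↦
    EigenClassesFinite.forall_zsmul_two_pow_baseChange_eq_zero_of_hasSurjectiveModNGaloisRep_two W K h2 hs2 m P
      (by exact_mod_cast hP)
  -- `#Sel₂(W^{(d_K)}) = #Sel₂(Wd) ≠ 1`, at the level `2^1`
  have hcardT' : Nat.card ((W.quadraticTwist ((NumberField.discr K : ℤ) : ℚ)).selmerGroup 2) ≠ 1 := by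
    have h := natCard_selmerGroup_smul (W.quadraticTwist ((NumberField.discr K : ℤ) : ℚ)) Cd (n := 2) two_ne_zero
    simp only [Nat.cast_ofNat] at h
    have hWd' : Cd • W.quadraticTwist ((NumberField.discr K : ℤ) : ℚ) = Wd := hWd
    rw [← h, hWd']
    exact hcard
  have hcardT : Nat.card ((W.quadraticTwist ((NumberField.discr K : ℤ) : ℚ)).selmerGroup ((2 ^ 1 : ℕ) : ℤ)) ≠ 1 := by
    rw [show ((2 ^ 1 : ℕ) : ℤ) = 2 from by norm_num]
    exact hcardT'
  -- a nonzero `2`-Selmer class of the twin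
  obtain ⟨s, hs, hs0⟩ : ∃ s : galH1Torsion (W.quadraticTwist ((NumberField.discr K : ℤ) : ℚ)) ((2 ^ 1 : ℕ) : ℤ),
      s ∈ selmerGroup (W.quadraticTwist ((NumberField.discr K : ℤ) : ℚ)) ((2 ^ 1 : ℕ) : ℤ) ∧ s ≠ 0 := by
    by_contra hnone
    have hnone' : ∀ s ∈ selmerGroup (W.quadraticTwist ((NumberField.discr K : ℤ) : ℚ)) ((2 ^ 1 : ℕ) : ℤ), s = 0 :=
      fun s hs ↦ by_contra fun h ↦ hnone ⟨s, hs, h⟩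
    apply hcardT
    have hbot : selmerGroup (W.quadraticTwist ((NumberField.discr K : ℤ) : ℚ)) ((2 ^ 1 : ℕ) : ℤ) = ⊥ :=
      (AddSubgroup.eq_bot_iff_forall _).mpr hnone'
    rw [hbot]
    exact AddSubgroup.card_bot
  -- lift to level `2^2`: Selmer, and nonzero by the injectivity of `ι` on `H¹(K, W[2^·])` through `hPsiKT ∘ res`
  have hdvd : ((2 ^ 1 : ℕ) : ℤ) ∣ ((2 ^ (1 + 1) : ℕ) : ℤ) := KolyvaginPairDataTwo.two_pow_dvd_two_pow_succ 1
  refine ⟨torsionH1OfDvd (W.quadraticTwist ((NumberField.discr K : ℤ) : ℚ)) hdvd s,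
    torsionH1OfDvd_mem_selmerGroup (W.quadraticTwist ((NumberField.discr K : ℤ) : ℚ)) hdvd hs, fun h0 ↦ hs0 ?_⟩
  have hinjι : Function.Injective (torsionH1OfDvd (W.baseChange K) hdvd) := KolyvaginPairDataTwo.torsionH1OfDvd_succ_injective W 1 hIQ hs2
  have hinjres : Function.Injective (resTorsion (W.quadraticTwist ((NumberField.discr K : ℤ) : ℚ)) K ((2 ^ 1 : ℕ) : ℤ)) :=
    EigenClassesFinite.resTorsion_twist_injective_of_noTorsion W K h2 hθ hd ((2 ^ 1 : ℕ) : ℤ) (htorsK 1)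
  apply hinjres
  apply (hPsiKT W K hθ hd ((2 ^ 1 : ℕ) : ℤ)).injective
  apply hinjι
  rw [← SelmerDescent.hPsiKT_torsionH1OfDvd W hθ hd hdvd,
    ← SelmerDescent.resTorsion_torsionH1OfDvd (W.quadraticTwist ((NumberField.discr K : ℤ) : ℚ)) K hdvd s, h0, map_zero, map_zero, map_zero,
    map_zero, map_zero]

/-! ## §2 U₂ on the cut from WALL row 1 + PRINT + Q2 + a door-closed depth-one frame supply -/

/-- **U₂ ON THE WHOLE ODD HABITAT CUT ⟸ WALL row 1 + PRINT + Q2 + FRAME¹♯-SUPPLY** (route vocabulary; NO Kolyvagin-conjecture input): for every `W` on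
the cut ONE odd Heegner frame `K ≠ ℚ(√−3)`, an odd-`c` datum, a conductor-`1` datum whose `P(1)` has infinite order and EXACT DEPTH ONE, and a globally
minimal twin model `Wd` inside the genus budget with **`#Sel₂(Wd) ≠ 1`** (door CLOSED).  §1 turns the door bit into the nonzero `4`-Selmer class of the
twin; then `minimalTwinBSDTwo_onOddCut_of_wall_of_depthOneFrameSupply_of_facts` (B2Q♭⁻± at depth one).  FRAME¹♯ is OPEN; CONDITIONAL; closes nothing;
BSD is NOT proved. [cite: Kolyvagin1989Izv, Thm. A, Thm. B_l] [cite: McCallumLMS1991, §5] [cite: MazurRubin2010, Cor. 3.4 (i)] -/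
theorem minimalTwinBSDTwo_onOddCut_of_wall_of_doorClosedDepthOneFrameSupply_of_facts (hQ2 : KolyvaginRelationAtTwo)
    (hGZ : ∀ (N : ℕ) [NeZero N] (W : WeierstrassCurve ℚ) (K : Type) [Field K] [NumberField K], gross_zagier N W K)
    (hGZK : rank_eq_analyticRank_of_analyticRank_le_one) (hmod : hasEntireLFunction_rat)
    (hMilneC : Milne1972.bsdQuotient_baseChange_quadratic_anyModel)
    (hS1 : ∀ (W : WeierstrassCurve ℚ) [W.IsElliptic] [W.IsGloballyMinimal], ¬ W.HasCM → W.analyticRank = 0 → BSDp W 2)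
    (hSupply1 : ∀ (W : WeierstrassCurve ℚ) [W.IsElliptic] [W.IsGloballyMinimal] [NeZero (W.conductorNorm ℤ)],
      ¬ W.HasCM → W.analyticRank = 1 → Nat.card (W.selmerGroup 2) = 2 → Odd W.tamagawaProduct →
      (∀ n : ℕ, 0 < n → W.HasSurjectiveModNGaloisRep ((2 : ℤ) ^ n)) →
      (∃ v : HeightOneSpectrum (𝓞 ℚ), ((2 : ℕ) : 𝓞 ℚ) ∉ v.asIdeal ∧ ((W.conductorNorm ℤ : ℕ) : 𝓞 ℚ) ∈ v.asIdeal ∧ W.HasMultiplicativeReductionAt v) →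
      ∃ (K : Type) (_ : Field K) (_ : NumberField K), IsImaginaryQuadratic K ∧ Odd (NumberField.discr K) ∧ NumberField.discr K ≠ -3 ∧
        SatisfiesHeegnerHypothesis (W.conductorNorm ℤ) K ∧
        ∃ (Dt : ModularParametrizationData W (W.conductorNorm ℤ)) (β : ℤ) (ι : K →+* ℂ) (d₁ : KolyvaginHeegnerData Dt β ι 1),
          Odd Dt.c ∧ ¬ IsOfFinAddOrder d₁.derivedPoint ∧
          (∃ Q : (W.baseChange (ringClassField K ι 1)).toAffine.Point, ((2 ^ 1 : ℕ) : ℤ) • Q = d₁.derivedPoint) ∧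
          (¬ ∃ Q : (W.baseChange (ringClassField K ι 1)).toAffine.Point, ((2 ^ (1 + 1) : ℕ) : ℤ) • Q = d₁.derivedPoint) ∧
          ∃ (Wd : WeierstrassCurve ℚ) (_ : Wd.IsElliptic) (_ : Wd.IsGloballyMinimal),
            (∃ C : VariableChange ℚ, C • W.quadraticTwist (NumberField.discr K : ℚ) = Wd) ∧
              ((W.Δ < 0 ∧ padicValNat 2 Wd.tamagawaProduct ≤ 1) ∨ padicValNat 2 Wd.tamagawaProduct = 0) ∧
              Nat.card (Wd.selmerGroup 2) ≠ 1) :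
    ∀ (W : WeierstrassCurve ℚ) [W.IsElliptic] [W.IsGloballyMinimal] [NeZero (W.conductorNorm ℤ)],
      ¬ W.HasCM → W.analyticRank = 1 → Nat.card (W.selmerGroup 2) = 2 → Odd W.tamagawaProduct →
      (∀ n : ℕ, 0 < n → W.HasSurjectiveModNGaloisRep ((2 : ℤ) ^ n)) →
      (∃ v : HeightOneSpectrum (𝓞 ℚ), ((2 : ℕ) : 𝓞 ℚ) ∉ v.asIdeal ∧ ((W.conductorNorm ℤ : ℕ) : 𝓞 ℚ) ∈ v.asIdeal ∧ W.HasMultiplicativeReductionAt v) →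
      BSDp W 2 := by
  refine minimalTwinBSDTwo_onOddCut_of_wall_of_depthOneFrameSupply_of_facts hQ2 hGZ hGZK hmod hMilneC hS1 fun W _ _ _ hcm hr hSel hT hρ hv ↦ ?_
  obtain ⟨K, iF, iN, hK, hodd, h3, hH, Dt, β, ι, d₁, hc, hy, hdiv, hndiv, Wd, iE, iM, ⟨Cd, hCd⟩, hbudget, hdoor⟩ :=
    hSupply1 W hcm hr hSel hT hρ hv
  have hD0 : ((NumberField.discr K : ℤ) : ℚ) ≠ 0 := by exact_mod_cast NumberField.discr_ne_zero K
  haveI iT : (W.quadraticTwist ((NumberField.discr K : ℤ) : ℚ)).IsElliptic := W.isElliptic_quadraticTwist hD0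
  have hs2 : W.HasSurjectiveModNGaloisRep 2 := by simpa using hρ 1 one_pos
  obtain ⟨s₀, hs₀, hs0⟩ := exists_selmer_twist_four_ne_zero_of_natCard_selmerGroup_two_ne_one W K hK hs2 Cd hCd hdoor
  exact ⟨K, iF, iN, hK, hodd, h3, hH, Dt, β, ι, d₁, hc, hy, hdiv, hndiv, ⟨Wd, iE, iM, ⟨Cd, hCd⟩, hbudget⟩, iT, 1 + 1, s₀, le_rfl, hs₀, hs0⟩

end Summit.BirchSwinnertonDyer.BirchSwinnertonDyer.Theorems.GenusExact.TwinSwap.TwinAnnihilation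

end
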